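import Summits.QuantumFields.BalabanUV.Beta.SymCorrectorFaceGauge

/-!
# `BalabanUV.Beta.SymCorrectorFaceWeight` — road «BF-x», binder row D1, slot (K) ∕ junction (J1), PART 24 HEAD rows (mix-face) ∕ (Λf): **THE FACE WEIGHT's DECAY LETTER
# IN THE `hg` SHAPE** (leaf-03 g32, TT24; OFFER — files on the OWNER's «WANTED»).  TT10 `SymCorrectorFaceGauge.abs_blockSymbol_le` bounds the dressed block symbol
# READ THROUGH A LEG (`w := legSite ρ z b`, constant carrying `e^{δ|ρ|₁}`); the HEAD's pricing of the face rows — `½·tadpole G₀ (WMs[G₀])` (TT21 `tadpole_WMs_eq`: half the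
# commutator word `conjV (V_H ν y′) (Θ′ μ y) + swap`, `Θ′ μ y = diagK (z b ↦ Σ_α Σ_{x ∈ blockSitesF n (blk n (legSite ϱ z b))} colH K n μ y α x·(2·faceWt r n α x))`) and
# `½·tadpole G₀ (W^{Λ}_f)` (`W^{Λ}_f = Wmix(Λf; V_{S♭}) − Wmix(Λf; V_{S⁰})`, `Λf` the same symbol at scalar `n⁴∕2`, negated) — goes through leaf-01 g32's
# `ColumnGaugePairContact.vertexFamily₂_Wmix_of_weight`, whose weight socket reads `hg : ∀ μ y w, |ξ·χ μ y w| ≤ G·e^{−δ|w − N•y|₁}` with the generator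
# `diagK (z b ↦ ξ·χ μ y (legSite ρ z b))`, i.e. the weight BEFORE the leg is applied.  §1 `abs_faceWeight_le`: for `Decays K C δ` (`δ ≥ 0`) and coefficients `|c α x| ≤ B`,
# `|Σ_α Σ_{x ∈ blockSitesF n (blk n w)} colH K n μ y α x·c α x| ≤ ((d+1)·n^{d+1}·(C·B)·e^{δ(d+1)n})·e^{−δ|w − n•y|₁}` (any site `w`; one triangle inequality inside the block of `w`);
# `abs_faceGenWeight_le`: the `faceWt` instance with a free outer scalar `ξ′` — EXACTLY the `hg` socket at `χ μ y w := Σ_α Σ_{x ∈ blockSitesF n (blk n w)} colH K n μ y α x·(ξ·faceWt r n α x)`,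
# `G := |ξ′|·((d+1)·n^{d+1}·(C·(|ξ|·faceWtSum r n))·e^{δ(d+1)n})`.  §2 `biLoc_faceGen_of_decays`: the un-negated face generator `Θ′ μ y` is `BiLoc` at `(n•y, n•y)` with the
# DISPLAYED constant `(d+1)·n^{d+1}·(C·(|ξ|·faceWtSum r n))·e^{δ(|ϱ|₁ + (d+1)n)}`, rate `δ∕2` (TT10 `biLoc_diagK_of_abs_le` + `abs_blockSymbol_le`; TT14's `loc_faceGen` is its `∃`-packing).

HONEST DEPENDENCY (cell records, verbatim): «continuum YM on T⁴ ⇐ BetaPertH ∧ nine spine estimates (0/9 proved); BetaPertH ⇐ (D1) ∧ (D4) ∧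
CAP+tail; G-an2-4 gates asym, D1 and NE2/3/4.»  HONEST FRAMING (cell contract, verbatim): «discharging `BetaPertH` makes Bałaban's UV stability
UNCONDITIONAL — a real constructive-QFT result; it is NOT the continuum limit and NOT the Clay problem.»  THIS MODULE is [folklore] finite-sum bookkeeping BY NAME over
lit-balaban's `abs_colH_le`, TT3a∕TT10's `l1_sub_le_of_mem_blockSitesF` ∕ `card_blockSitesF` ∕ `abs_faceWt_le` ∕ `biLoc_diagK_of_abs_le` ∕ `abs_blockSymbol_le`; an entrywise LETTER with a
displayed constant — it bounds a WEIGHT, prices NO (1.22) row by itself; no definition, no `def … : Prop`, nothing cited, 0 sorry.  0∕4 row-D1 binders; (J1) ONE OPEN ROW; (K) NOT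
closed; NOT D1, NEVER «G-an2-4 closed», NOT `BetaPertH`, NOT continuum, NOT Clay.

ABSOLUTE RULE (cell charter, verbatim): «No internally-minted statement may enter as a cited fact. Every hypothesis is either kernel-proved in
this package or a verbatim quotation of a PUBLISHED theorem with page reference. The manuscript(s) under audit are NOT citable for their own
disputed steps — they are the thing under adjudication; programme-internal (2001/route/tribunal) claims are never citable.»

Unit `b2b-balaban-beta-d1-formalise-leaf-03` (gen 32), 2026-08-23.  No existing file touched.
-/

noncomputable section

namespace Summit.QuantumFields.BalabanUV.Beta.SymCorrectorFaceWeight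

open Finset
open scoped BigOperators
open Literature.MathematicalPhysics.QuantumFieldTheory
open Literature.MathematicalPhysics.QuantumFieldTheory.Balaban1983to89
open Literature.MathematicalPhysics.QuantumFieldTheory.Balaban1983to89.Beta
open B12Sec2to5 (l1 l1_nonneg)
open ExpKernelCalculus (MKer Decays BiLoc l1_sub_triangle l1_sub_symm)
open OneStepResolventKernel (Fib)
open OneStepKernelFamily (colH abs_colH_le)
open AffineAveraging (Site)
open AveragingContours (blk)
open Summit.QuantumFields.BalabanUV.Beta.BorderedHessian (diagK)
open Summit.QuantumFields.BalabanUV.Beta.AveragingWardRootedStencils (legSite)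
open Summit.QuantumFields.BalabanUV.Beta.CompositeCorrectorLocality (blockSitesF)
open Summit.QuantumFields.BalabanUV.Beta.SymCorrectorFace (faceWt faceWtSum faceWtSum_nonneg abs_faceWt_le card_blockSitesF)
open Summit.QuantumFields.BalabanUV.Beta.SymCorrectorFaceGauge (l1_sub_le_of_mem_blockSitesF abs_blockSymbol_le biLoc_diagK_of_abs_le)

variable {d : ℕ} {n : ℕ} (hn : 0 < n)
include hn

/-! ## §1 The face weight decays from the coarse point — the `hg` socket of leaf-01's `vertexFamily₂_Wmix_of_weight` -/

/-- [folklore] **THE DRESSED BLOCK SYMBOL AT A SITE DECAYS FROM THE COARSE POINT**: for `Decays K C δ` (`δ ≥ 0`) and coefficients `|c α x| ≤ B` (`B ≥ 0`), at ANY site `w`,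
`|Σ_α Σ_{x ∈ blockSitesF n (blk n w)} colH K n μ y α x·c α x| ≤ ((d+1)·n^{d+1}·(C·B)·e^{δ(d+1)n})·e^{−δ|w − n•y|₁}` — the column decays from `n•y`, the block of `w` is within
`(d+1)n` of `w` (TT10 `abs_blockSymbol_le` without the leg: no `|ρ|₁` in the constant). -/
theorem abs_faceWeight_le {K : MKer (d + 1) (Fib d)} {C δ : ℝ} (hK : Decays K C δ) (hδ : 0 ≤ δ)
    {c : Fin (d + 1) → Site (d + 1) → ℝ} {B : ℝ} (hc : ∀ α x, |c α x| ≤ B) (hB : 0 ≤ B) (μ : Fin (d + 1)) (y w : Site (d + 1)) :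
    |∑ α : Fin (d + 1), ∑ x ∈ blockSitesF n (blk n w), colH K n μ y α x * c α x|
      ≤ (((d + 1 : ℕ) : ℝ) * (n : ℝ) ^ (d + 1) * (C * B) * Real.exp (δ * (((d + 1 : ℕ) : ℝ) * n)))
        * Real.exp (-δ * l1 (w - (n : ℤ) • y)) := by
  have hC : 0 ≤ C := by
    have h := hK 0 0 (Sum.inl 0) (Sum.inl 0)
    rw [sub_self] at h
    have : l1 (0 : Site (d + 1)) = 0 := by simp [B12Sec2to5.l1]
    rw [this, mul_zero, Real.exp_zero, mul_one] at h
    exact (abs_nonneg _).trans h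
  -- each term
  have hterm : ∀ α, ∀ x ∈ blockSitesF n (blk n w),
      |colH K n μ y α x * c α x| ≤ C * B * Real.exp (δ * (((d + 1 : ℕ) : ℝ) * n)) * Real.exp (-δ * l1 (w - (n : ℤ) • y)) := by
    intro α x hx
    rw [abs_mul]
    have h1 := abs_colH_le (N := n) hK μ y α x
    have h2 := hc α x
    -- `|w − n•y| ≤ |w − x| + |x − n•y| ≤ (d+1)n + |x − n•y|`
    have hwx : l1 (w - x) ≤ ((d + 1 : ℕ) : ℝ) * n := by rw [l1_sub_symm]; exact l1_sub_le_of_mem_blockSitesF hn hx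
    have htri : l1 (w - (n : ℤ) • y) ≤ ((d + 1 : ℕ) : ℝ) * n + l1 (x - (n : ℤ) • y) := by
      have := l1_sub_triangle w x ((n : ℤ) • y); linarith
    have hexp : Real.exp (-δ * l1 (x - (n : ℤ) • y))
        ≤ Real.exp (δ * (((d + 1 : ℕ) : ℝ) * n)) * Real.exp (-δ * l1 (w - (n : ℤ) • y)) := by
      rw [← Real.exp_add]
      exact Real.exp_le_exp.2 (by nlinarith)
    calc |colH K n μ y α x| * |c α x| ≤ (C * Real.exp (-δ * l1 (x - (n : ℤ) • y))) * B :=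
          mul_le_mul h1 h2 (abs_nonneg _) (by positivity)
      _ = C * B * Real.exp (-δ * l1 (x - (n : ℤ) • y)) := by ring
      _ ≤ C * B * (Real.exp (δ * (((d + 1 : ℕ) : ℝ) * n)) * Real.exp (-δ * l1 (w - (n : ℤ) • y))) :=
          mul_le_mul_of_nonneg_left hexp (by positivity)
      _ = _ := by ring
  calc |∑ α : Fin (d + 1), ∑ x ∈ blockSitesF n (blk n w), colH K n μ y α x * c α x|
      ≤ ∑ α : Fin (d + 1), |∑ x ∈ blockSitesF n (blk n w), colH K n μ y α x * c α x| := Finset.abs_sum_le_sum_abs _ _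
    _ ≤ ∑ α : Fin (d + 1), ∑ x ∈ blockSitesF n (blk n w), |colH K n μ y α x * c α x| :=
        Finset.sum_le_sum fun α _ => Finset.abs_sum_le_sum_abs _ _
    _ ≤ ∑ α : Fin (d + 1), ∑ x ∈ blockSitesF n (blk n w),
          C * B * Real.exp (δ * (((d + 1 : ℕ) : ℝ) * n)) * Real.exp (-δ * l1 (w - (n : ℤ) • y)) :=
        Finset.sum_le_sum fun α _ => Finset.sum_le_sum fun x hx => hterm α x hx
    _ = _ := by
        rw [Finset.sum_const, Finset.sum_const, card_blockSitesF, Finset.card_univ, Fintype.card_fin, nsmul_eq_mul, nsmul_eq_mul]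
        push_cast
        ring

/-- [folklore] **THE FACE GENERATOR's WEIGHT IN THE `hg` SHAPE**: with a free outer scalar `ξ′` (take `ξ′ := 1` for TT21's `Θ′`, `ξ′ := −1` for the face gauge generator
`Λf`), for every `μ y w`,
`|ξ′·(Σ_α Σ_{x ∈ blockSitesF n (blk n w)} colH K n μ y α x·(ξ·faceWt r n α x))| ≤ (|ξ′|·((d+1)·n^{d+1}·(C·(|ξ|·faceWtSum r n))·e^{δ(d+1)n}))·e^{−δ|w − n•y|₁}` — the socket `hg` of
leaf-01 g32's `ColumnGaugePairContact.vertexFamily₂_Wmix_of_weight` at `χ μ y w := Σ_α Σ_{x ∈ blockSitesF n (blk n w)} colH K n μ y α x·(ξ·faceWt r n α x)`. -/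
theorem abs_faceGenWeight_le {K : MKer (d + 1) (Fib d)} {C δ : ℝ} (hK : Decays K C δ) (hδ : 0 ≤ δ) (r : Fin (d + 1) → ℕ) (ξ ξ' : ℝ)
    (μ : Fin (d + 1)) (y w : Site (d + 1)) :
    |ξ' * ∑ α : Fin (d + 1), ∑ x ∈ blockSitesF n (blk n w), colH K n μ y α x * (ξ * faceWt r n α x)|
      ≤ (|ξ'| * (((d + 1 : ℕ) : ℝ) * (n : ℝ) ^ (d + 1) * (C * (|ξ| * faceWtSum r n)) * Real.exp (δ * (((d + 1 : ℕ) : ℝ) * n))))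
        * Real.exp (-δ * l1 (w - (n : ℤ) • y)) := by
  have hc : ∀ α x, |ξ * faceWt r n α x| ≤ |ξ| * faceWtSum r n := fun α x => by
    rw [abs_mul]; exact mul_le_mul_of_nonneg_left (abs_faceWt_le hn r α x) (abs_nonneg ξ)
  rw [abs_mul, mul_assoc]
  exact mul_le_mul_of_nonneg_left (abs_faceWeight_le hn hK hδ hc (mul_nonneg (abs_nonneg ξ) (faceWtSum_nonneg r n)) μ y w) (abs_nonneg ξ')

/-! ## §2 The un-negated face generator `Θ′` is bi-localised at the coarse point, constant displayed -/

/-- [folklore] **`Θ′ μ y` IS `BiLoc` AT `(n•y, n•y)` WITH A DISPLAYED CONSTANT** (TT14 `loc_faceGen` un-packed): for `Decays K C δ` (`δ ≥ 0`), any leg root `ϱ`, any `r`, `ξ`,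
`BiLoc (diagK (z b ↦ Σ_α Σ_{x ∈ blockSitesF n (blk n (legSite ϱ z b))} colH K n μ y α x·(ξ·faceWt r n α x))) (n•y) (n•y) ((d+1)·n^{d+1}·(C·(|ξ|·faceWtSum r n))·e^{δ(|ϱ|₁ + (d+1)n)}) (δ∕2)`. -/
theorem biLoc_faceGen_of_decays {K : MKer (d + 1) (Fib d)} {C δ : ℝ} (hK : Decays K C δ) (hδ : 0 ≤ δ) (ϱ : Site (d + 1)) (r : Fin (d + 1) → ℕ) (ξ : ℝ)
    (μ : Fin (d + 1)) (y : Site (d + 1)) :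
    BiLoc (diagK fun z b => ∑ α : Fin (d + 1), ∑ x ∈ blockSitesF n (blk n (legSite ϱ z b)), colH K n μ y α x * (ξ * faceWt r n α x))
      ((n : ℤ) • y) ((n : ℤ) • y)
      (((d + 1 : ℕ) : ℝ) * (n : ℝ) ^ (d + 1) * (C * (|ξ| * faceWtSum r n)) * Real.exp (δ * (l1 ϱ + ((d + 1 : ℕ) : ℝ) * n))) (δ / 2) := by
  have hc : ∀ α x, |ξ * faceWt r n α x| ≤ |ξ| * faceWtSum r n := fun α x => by
    rw [abs_mul]; exact mul_le_mul_of_nonneg_left (abs_faceWt_le hn r α x) (abs_nonneg ξ)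
  exact biLoc_diagK_of_abs_le fun z b => abs_blockSymbol_le hn hK hδ ϱ hc (mul_nonneg (abs_nonneg ξ) (faceWtSum_nonneg r n)) μ y z b

/-! ## §3 (v1.1, gen 33, APPEND-ONLY) The face weight in MASS currency: its block mass IS `faceWtSum` at every block, and the decay letters of §1–§2 ∕ TT10 lose the
factor `(d+1)·n^{d+1}` — the column is read by its SUP over the block (a COLUMN ENVELOPE `hcol`, or `Decays K C δ`), the weight by its BLOCK MASS (`ℓ¹`), instead of
sup × sup × (number of block bonds)

The OWNER d1-p2 g25's design note N-g25-1 (journal l.54036) names the PACKED∕MASS currency as the pricing currency of the HEAD's rows and lists the face weights `Θ′`, `Λf` of the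
rows (ms) ∕ (lamf) by TT24's constant `(d+1)·n^{d+1}·C·(|ξ|·faceWtSum r n)·e^{δ(d+1)n}`.  That constant reads the weight through the UNIFORM bound `|faceWt r n α x| ≤ faceWtSum r n`
(`abs_faceWt_le`) and then COUNTS the `(d+1)·n^{d+1}` bonds of the block — it pays the block mass `faceWtSum` once per bond.  Here the same symbol is bounded by
`C·(Σ_α Σ_{x ∈ block} |ξ·faceWt r n α x|)·e^{δ(d+1)n} = C·(|ξ|·faceWtSum r n)·e^{δ(d+1)n}`: `blockMass_faceWt_eq_faceWtSum` (the block mass of the face weight is the finite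
table `faceWtSum` at EVERY block — block covariance `faceWt_shift` + the box re-indexing `sum_blockSitesF_eq_sum_box`); the `_of_col` letters take a COLUMN ENVELOPE
`hcol : ∀ α x, |colH K n μ y α x| ≤ C·e^{−δ|x − n•y|₁}` (the socket for gan24-leaf-05 g53's dressed-column envelope `PackedColumnEnvelope.abs_colH_G₀_road_le`, whose `C` carries `(n⁴)⁻¹`,
one power sharper than any `Decays` letter of the whole kernel), the un-suffixed ones `Decays K C δ` as in §1–§2 (lit `abs_colH_le`): `abs_faceWeight_le_mass(_of_col)` ∕
`abs_faceGenWeight_le_mass(_of_col)` (the `hg` socket of leaf-01's `vertexFamily₂_Wmix_of_weight`, `(d+1)·n^{d+1}`-free), `abs_blockSymbol_le_mass(_of_col)` (TT10's leg form),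
`biLoc_faceGen_mass(_of_col)` ∕ `biLoc_faceGauge_mass(_of_col)` (§2's and TT10's `BiLoc` letters for `Θ′` ∕ `Λf = −Θ′[ξ]`, `(d+1)·n^{d+1}`-free).  HONEST: an entrywise letter, [folklore]
finite-sum bookkeeping; NO claim on the size of the finite number `faceWtSum r n` along `n` (at the centred root it is gan24-leaf-05 g58's `BondIndicatorGaugeL1.sum_box_abs_zetaS_delta1_le`,
not restated here); prices NO (1.22) row by itself; §1–§2 above BYTE-IDENTICAL.
Unit `b2b-balaban-beta-d1-formalise-leaf-03` (gen 33), 2026-08-23. -/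

section Mass

open AffineAveraging (box toSite)
open AveragingContours (off off_mem_box blk_add_off blk_block)
open AxialProjector (toSite_injective)
open Summit.QuantumFields.BalabanUV.Beta.CompositeCorrectorLocality (mem_blockSitesF_of_blk_eq)
open Summit.QuantumFields.BalabanUV.Beta.SymCorrectorFace (faceWt_shift)
open Summit.QuantumFields.BalabanUV.Beta.SymCorrectorFaceDiv (mem_blockSitesF_iff)
open Summit.QuantumFields.BalabanUV.Beta.SymCorrectorFaceGauge (l1_sub_legSite_le)

/-- [folklore] **RE-INDEXING A BLOCK SUM BY THE BOX**: `Σ_{x ∈ blockSitesF n Y} f x = Σ_{b ∈ box (d+1) n} f (n•Y + b)` — `x ↦ off n x` and `b ↦ n•Y + b` are inverse bijections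
between the block `Y` and the box (`blk_add_off`, `blk_block`, `off_mem_box`). -/
theorem sum_blockSitesF_eq_sum_box (f : Site (d + 1) → ℝ) (Y : Site (d + 1)) :
    ∑ x ∈ blockSitesF n Y, f x = ∑ b ∈ box (d + 1) n, f ((n : ℤ) • Y + toSite b) := by
  have hn1 : 1 ≤ n := hn
  have hleft : ∀ x ∈ blockSitesF n Y, (n : ℤ) • Y + toSite (off n x) = x := by
    intro x hx
    have h := blk_add_off hn1 x
    rwa [(mem_blockSitesF_iff hn).1 hx] at h
  refine Finset.sum_nbij' (fun x => off n x) (fun b => (n : ℤ) • Y + toSite b) (fun x _ => off_mem_box hn1 x)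
    (fun b hb => mem_blockSitesF_of_blk_eq hn (blk_block Y hb)) hleft (fun b hb => ?_) (fun x hx => by rw [hleft x hx])
  apply toSite_injective
  have h := blk_add_off hn1 ((n : ℤ) • Y + toSite b)
  rw [blk_block Y hb] at h
  exact add_left_cancel h

/-- [folklore] **THE BLOCK MASS OF THE FACE WEIGHT IS `faceWtSum`, AT EVERY BLOCK**: `Σ_α Σ_{x ∈ blockSitesF n Y} |faceWt r n α x| = faceWtSum r n` (block covariance
`faceWt_shift`: the table over the block `Y` is the table over the box). -/
theorem blockMass_faceWt_eq_faceWtSum (r : Fin (d + 1) → ℕ) (Y : Site (d + 1)) :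
    ∑ α : Fin (d + 1), ∑ x ∈ blockSitesF n Y, |faceWt r n α x| = faceWtSum r n := by
  unfold faceWtSum
  refine Finset.sum_congr rfl fun α _ => ?_
  rw [sum_blockSitesF_eq_sum_box hn]
  refine Finset.sum_congr rfl fun b _ => ?_
  rw [add_comm, faceWt_shift hn]

/-- [folklore] The block mass of the scaled face weight: `Σ_α Σ_{x ∈ blockSitesF n Y} |ξ·faceWt r n α x| = |ξ|·faceWtSum r n`. -/
theorem blockMass_smul_faceWt_eq (r : Fin (d + 1) → ℕ) (ξ : ℝ) (Y : Site (d + 1)) :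
    ∑ α : Fin (d + 1), ∑ x ∈ blockSitesF n Y, |ξ * faceWt r n α x| = |ξ| * faceWtSum r n := by
  rw [← blockMass_faceWt_eq_faceWtSum hn r Y, Finset.mul_sum]
  refine Finset.sum_congr rfl fun α _ => ?_
  rw [Finset.mul_sum]
  refine Finset.sum_congr rfl fun x _ => ?_
  rw [abs_mul]

/-- [folklore] **THE DRESSED BLOCK SYMBOL AT A SITE, IN MASS CURRENCY, FROM A COLUMN ENVELOPE**: if the column `(μ, y)` of `K` obeys `|colH K n μ y α x| ≤ C·e^{−δ|x − n•y|₁}` (`C, δ ≥ 0`)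
and the coefficients have BLOCK MASS `Σ_α Σ_{x ∈ blockSitesF n Y} |c α x| ≤ B` at every block `Y`, then at ANY site `w`:
`|Σ_α Σ_{x ∈ blockSitesF n (blk n w)} colH K n μ y α x·c α x| ≤ (C·B·e^{δ(d+1)n})·e^{−δ|w − n•y|₁}` — the column's sup over the block of `w` (within `(d+1)n` of `w`) times the block mass. -/
theorem abs_faceWeight_le_mass_of_col {K : MKer (d + 1) (Fib d)} {C δ : ℝ} (hC : 0 ≤ C) (hδ : 0 ≤ δ) {μ : Fin (d + 1)} {y : Site (d + 1)}
    (hcol : ∀ α x, |colH K n μ y α x| ≤ C * Real.exp (-δ * l1 (x - (n : ℤ) • y)))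
    {c : Fin (d + 1) → Site (d + 1) → ℝ} {B : ℝ} (hc : ∀ Y, ∑ α : Fin (d + 1), ∑ x ∈ blockSitesF n Y, |c α x| ≤ B) (w : Site (d + 1)) :
    |∑ α : Fin (d + 1), ∑ x ∈ blockSitesF n (blk n w), colH K n μ y α x * c α x|
      ≤ (C * B * Real.exp (δ * (((d + 1 : ℕ) : ℝ) * n))) * Real.exp (-δ * l1 (w - (n : ℤ) • y)) := by
  set E : ℝ := C * Real.exp (δ * (((d + 1 : ℕ) : ℝ) * n)) * Real.exp (-δ * l1 (w - (n : ℤ) • y)) with hE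
  have hE0 : 0 ≤ E := by positivity
  -- the column's sup over the block of `w`
  have hsup : ∀ α, ∀ x ∈ blockSitesF n (blk n w), |colH K n μ y α x| ≤ E := by
    intro α x hx
    have hwx : l1 (w - x) ≤ ((d + 1 : ℕ) : ℝ) * n := by rw [l1_sub_symm]; exact l1_sub_le_of_mem_blockSitesF hn hx
    have htri : l1 (w - (n : ℤ) • y) ≤ ((d + 1 : ℕ) : ℝ) * n + l1 (x - (n : ℤ) • y) := by
      have := l1_sub_triangle w x ((n : ℤ) • y); linarith
    have hexp : Real.exp (-δ * l1 (x - (n : ℤ) • y))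
        ≤ Real.exp (δ * (((d + 1 : ℕ) : ℝ) * n)) * Real.exp (-δ * l1 (w - (n : ℤ) • y)) := by
      rw [← Real.exp_add]
      exact Real.exp_le_exp.2 (by nlinarith)
    calc |colH K n μ y α x| ≤ C * Real.exp (-δ * l1 (x - (n : ℤ) • y)) := hcol α x
      _ ≤ C * (Real.exp (δ * (((d + 1 : ℕ) : ℝ) * n)) * Real.exp (-δ * l1 (w - (n : ℤ) • y))) := mul_le_mul_of_nonneg_left hexp hC
      _ = E := by rw [hE]; ring
  calc |∑ α : Fin (d + 1), ∑ x ∈ blockSitesF n (blk n w), colH K n μ y α x * c α x|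
      ≤ ∑ α : Fin (d + 1), |∑ x ∈ blockSitesF n (blk n w), colH K n μ y α x * c α x| := Finset.abs_sum_le_sum_abs _ _
    _ ≤ ∑ α : Fin (d + 1), ∑ x ∈ blockSitesF n (blk n w), |colH K n μ y α x * c α x| :=
        Finset.sum_le_sum fun α _ => Finset.abs_sum_le_sum_abs _ _
    _ ≤ ∑ α : Fin (d + 1), ∑ x ∈ blockSitesF n (blk n w), E * |c α x| :=
        Finset.sum_le_sum fun α _ => Finset.sum_le_sum fun x hx => by
          rw [abs_mul]; exact mul_le_mul_of_nonneg_right (hsup α x hx) (abs_nonneg _)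
    _ = E * ∑ α : Fin (d + 1), ∑ x ∈ blockSitesF n (blk n w), |c α x| := by
        rw [Finset.mul_sum]
        refine Finset.sum_congr rfl fun α _ => ?_
        rw [Finset.mul_sum]
    _ ≤ E * B := mul_le_mul_of_nonneg_left (hc (blk n w)) hE0
    _ = _ := by rw [hE]; ring

/-- [folklore] **THE DRESSED BLOCK SYMBOL AT A SITE, IN MASS CURRENCY** (`Decays K C δ` form): §1's `abs_faceWeight_le` without the factor `(d+1)·n^{d+1}` (`_of_col` + lit `abs_colH_le`). -/
theorem abs_faceWeight_le_mass {K : MKer (d + 1) (Fib d)} {C δ : ℝ} (hK : Decays K C δ) (hδ : 0 ≤ δ)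
    {c : Fin (d + 1) → Site (d + 1) → ℝ} {B : ℝ} (hc : ∀ Y, ∑ α : Fin (d + 1), ∑ x ∈ blockSitesF n Y, |c α x| ≤ B) (μ : Fin (d + 1)) (y w : Site (d + 1)) :
    |∑ α : Fin (d + 1), ∑ x ∈ blockSitesF n (blk n w), colH K n μ y α x * c α x|
      ≤ (C * B * Real.exp (δ * (((d + 1 : ℕ) : ℝ) * n))) * Real.exp (-δ * l1 (w - (n : ℤ) • y)) :=
  abs_faceWeight_le_mass_of_col hn (hK.nonneg (Sum.inl 0)) hδ (fun α x => abs_colH_le (N := n) hK μ y α x) hc w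

/-- [folklore] **THE FACE GENERATOR's WEIGHT IN THE `hg` SHAPE, MASS CURRENCY, FROM A COLUMN ENVELOPE**: with a free outer scalar `ξ′`, for the enveloped column `(μ, y)` and every `w`,
`|ξ′·(Σ_α Σ_{x ∈ blockSitesF n (blk n w)} colH K n μ y α x·(ξ·faceWt r n α x))| ≤ (|ξ′|·(C·(|ξ|·faceWtSum r n)·e^{δ(d+1)n}))·e^{−δ|w − n•y|₁}`. -/
theorem abs_faceGenWeight_le_mass_of_col {K : MKer (d + 1) (Fib d)} {C δ : ℝ} (hC : 0 ≤ C) (hδ : 0 ≤ δ) {μ : Fin (d + 1)} {y : Site (d + 1)}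
    (hcol : ∀ α x, |colH K n μ y α x| ≤ C * Real.exp (-δ * l1 (x - (n : ℤ) • y))) (r : Fin (d + 1) → ℕ) (ξ ξ' : ℝ) (w : Site (d + 1)) :
    |ξ' * ∑ α : Fin (d + 1), ∑ x ∈ blockSitesF n (blk n w), colH K n μ y α x * (ξ * faceWt r n α x)|
      ≤ (|ξ'| * (C * (|ξ| * faceWtSum r n) * Real.exp (δ * (((d + 1 : ℕ) : ℝ) * n))))
        * Real.exp (-δ * l1 (w - (n : ℤ) • y)) := by
  rw [abs_mul, mul_assoc]
  exact mul_le_mul_of_nonneg_left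
    (abs_faceWeight_le_mass_of_col hn hC hδ hcol (fun Y => le_of_eq (blockMass_smul_faceWt_eq hn r ξ Y)) w) (abs_nonneg ξ')

/-- [folklore] **THE FACE GENERATOR's WEIGHT IN THE `hg` SHAPE, MASS CURRENCY** (`Decays K C δ` form): §1's `abs_faceGenWeight_le` — the socket `hg` of leaf-01 g32's
`ColumnGaugePairContact.vertexFamily₂_Wmix_of_weight` — without the factor `(d+1)·n^{d+1}`. -/
theorem abs_faceGenWeight_le_mass {K : MKer (d + 1) (Fib d)} {C δ : ℝ} (hK : Decays K C δ) (hδ : 0 ≤ δ) (r : Fin (d + 1) → ℕ) (ξ ξ' : ℝ)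
    (μ : Fin (d + 1)) (y w : Site (d + 1)) :
    |ξ' * ∑ α : Fin (d + 1), ∑ x ∈ blockSitesF n (blk n w), colH K n μ y α x * (ξ * faceWt r n α x)|
      ≤ (|ξ'| * (C * (|ξ| * faceWtSum r n) * Real.exp (δ * (((d + 1 : ℕ) : ℝ) * n))))
        * Real.exp (-δ * l1 (w - (n : ℤ) • y)) :=
  abs_faceGenWeight_le_mass_of_col hn (hK.nonneg (Sum.inl 0)) hδ (fun α x => abs_colH_le (N := n) hK μ y α x) r ξ ξ' w

/-- [folklore] **THE DRESSED BLOCK SYMBOL THROUGH A LEG, IN MASS CURRENCY, FROM A COLUMN ENVELOPE** (TT10 `SymCorrectorFaceGauge.abs_blockSymbol_le` without the factor `(d+1)·n^{d+1}`):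
for the enveloped column `(μ, y)`, any leg root `ρ`, and coefficients of block mass `≤ B` at every block,
`|Σ_α Σ_{x ∈ blockSitesF n (blk n (legSite ρ z b))} colH K n μ y α x·c α x| ≤ (C·B·e^{δ(|ρ|₁ + (d+1)n)})·e^{−δ|z − n•y|₁}` (the leg's site is within `|ρ|₁` of `z`). -/
theorem abs_blockSymbol_le_mass_of_col {K : MKer (d + 1) (Fib d)} {C δ : ℝ} (hC : 0 ≤ C) (hδ : 0 ≤ δ) {μ : Fin (d + 1)} {y : Site (d + 1)}
    (hcol : ∀ α x, |colH K n μ y α x| ≤ C * Real.exp (-δ * l1 (x - (n : ℤ) • y))) (ρ : Site (d + 1))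
    {c : Fin (d + 1) → Site (d + 1) → ℝ} {B : ℝ} (hc : ∀ Y, ∑ α : Fin (d + 1), ∑ x ∈ blockSitesF n Y, |c α x| ≤ B) (z : Site (d + 1)) (b : Fib d) :
    |∑ α : Fin (d + 1), ∑ x ∈ blockSitesF n (blk n (legSite ρ z b)), colH K n μ y α x * c α x|
      ≤ (C * B * Real.exp (δ * (l1 ρ + ((d + 1 : ℕ) : ℝ) * n))) * Real.exp (-δ * l1 (z - (n : ℤ) • y)) := by
  have hB : 0 ≤ B := le_trans (Finset.sum_nonneg fun _ _ => Finset.sum_nonneg fun _ _ => abs_nonneg _) (hc 0)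
  have h := abs_faceWeight_le_mass_of_col hn hC hδ hcol hc (legSite ρ z b)
  have hzw : l1 (z - legSite ρ z b) ≤ l1 ρ := l1_sub_legSite_le ρ z b
  have htri : l1 (z - (n : ℤ) • y) ≤ l1 ρ + l1 (legSite ρ z b - (n : ℤ) • y) := by
    have := l1_sub_triangle z (legSite ρ z b) ((n : ℤ) • y); linarith
  have hexp : Real.exp (-δ * l1 (legSite ρ z b - (n : ℤ) • y)) ≤ Real.exp (δ * l1 ρ) * Real.exp (-δ * l1 (z - (n : ℤ) • y)) := by
    rw [← Real.exp_add]
    exact Real.exp_le_exp.2 (by nlinarith)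
  refine h.trans ?_
  calc C * B * Real.exp (δ * (((d + 1 : ℕ) : ℝ) * n)) * Real.exp (-δ * l1 (legSite ρ z b - (n : ℤ) • y))
      ≤ C * B * Real.exp (δ * (((d + 1 : ℕ) : ℝ) * n)) * (Real.exp (δ * l1 ρ) * Real.exp (-δ * l1 (z - (n : ℤ) • y))) :=
        mul_le_mul_of_nonneg_left hexp (by positivity)
    _ = _ := by rw [mul_add, Real.exp_add]; ring

/-- [folklore] **THE DRESSED BLOCK SYMBOL THROUGH A LEG, IN MASS CURRENCY** (`Decays K C δ` form). -/
theorem abs_blockSymbol_le_mass {K : MKer (d + 1) (Fib d)} {C δ : ℝ} (hK : Decays K C δ) (hδ : 0 ≤ δ) (ρ : Site (d + 1))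
    {c : Fin (d + 1) → Site (d + 1) → ℝ} {B : ℝ} (hc : ∀ Y, ∑ α : Fin (d + 1), ∑ x ∈ blockSitesF n Y, |c α x| ≤ B)
    (μ : Fin (d + 1)) (y z : Site (d + 1)) (b : Fib d) :
    |∑ α : Fin (d + 1), ∑ x ∈ blockSitesF n (blk n (legSite ρ z b)), colH K n μ y α x * c α x|
      ≤ (C * B * Real.exp (δ * (l1 ρ + ((d + 1 : ℕ) : ℝ) * n))) * Real.exp (-δ * l1 (z - (n : ℤ) • y)) :=
  abs_blockSymbol_le_mass_of_col hn (hK.nonneg (Sum.inl 0)) hδ (fun α x => abs_colH_le (N := n) hK μ y α x) ρ hc z b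

/-- [folklore] **`Θ′ μ y` IS `BiLoc` AT `(n•y, n•y)`, MASS CURRENCY, FROM A COLUMN ENVELOPE**: for the enveloped column `(μ, y)`, any leg root `ϱ`, any `r`, `ξ`,
`BiLoc (diagK (z b ↦ Σ_α Σ_{x ∈ blockSitesF n (blk n (legSite ϱ z b))} colH K n μ y α x·(ξ·faceWt r n α x))) (n•y) (n•y) (C·(|ξ|·faceWtSum r n)·e^{δ(|ϱ|₁ + (d+1)n)}) (δ∕2)`. -/
theorem biLoc_faceGen_mass_of_col {K : MKer (d + 1) (Fib d)} {C δ : ℝ} (hC : 0 ≤ C) (hδ : 0 ≤ δ) {μ : Fin (d + 1)} {y : Site (d + 1)}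
    (hcol : ∀ α x, |colH K n μ y α x| ≤ C * Real.exp (-δ * l1 (x - (n : ℤ) • y))) (ϱ : Site (d + 1)) (r : Fin (d + 1) → ℕ) (ξ : ℝ) :
    BiLoc (diagK fun z b => ∑ α : Fin (d + 1), ∑ x ∈ blockSitesF n (blk n (legSite ϱ z b)), colH K n μ y α x * (ξ * faceWt r n α x))
      ((n : ℤ) • y) ((n : ℤ) • y)
      (C * (|ξ| * faceWtSum r n) * Real.exp (δ * (l1 ϱ + ((d + 1 : ℕ) : ℝ) * n))) (δ / 2) :=
  biLoc_diagK_of_abs_le fun z b =>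
    abs_blockSymbol_le_mass_of_col hn hC hδ hcol ϱ (fun Y => le_of_eq (blockMass_smul_faceWt_eq hn r ξ Y)) z b

/-- [folklore] **`Θ′ μ y` IS `BiLoc` AT `(n•y, n•y)`, MASS CURRENCY** (`Decays K C δ` form): §2's `biLoc_faceGen_of_decays` without the factor `(d+1)·n^{d+1}`. -/
theorem biLoc_faceGen_mass {K : MKer (d + 1) (Fib d)} {C δ : ℝ} (hK : Decays K C δ) (hδ : 0 ≤ δ) (ϱ : Site (d + 1)) (r : Fin (d + 1) → ℕ) (ξ : ℝ)
    (μ : Fin (d + 1)) (y : Site (d + 1)) :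
    BiLoc (diagK fun z b => ∑ α : Fin (d + 1), ∑ x ∈ blockSitesF n (blk n (legSite ϱ z b)), colH K n μ y α x * (ξ * faceWt r n α x))
      ((n : ℤ) • y) ((n : ℤ) • y)
      (C * (|ξ| * faceWtSum r n) * Real.exp (δ * (l1 ϱ + ((d + 1 : ℕ) : ℝ) * n))) (δ / 2) :=
  biLoc_faceGen_mass_of_col hn (hK.nonneg (Sum.inl 0)) hδ (fun α x => abs_colH_le (N := n) hK μ y α x) ϱ r ξ

/-- [folklore] **THE FACE GAUGE GENERATOR `Λf μ y = −Θ′[ξ] μ y` IS `BiLoc` AT `(n•y, n•y)`, MASS CURRENCY, FROM A COLUMN ENVELOPE** (TT10 `SymCorrectorFaceGauge.biLoc_faceGauge` without the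
factor `(d+1)·n^{d+1}`). -/
theorem biLoc_faceGauge_mass_of_col {K : MKer (d + 1) (Fib d)} {C δ : ℝ} (hC : 0 ≤ C) (hδ : 0 ≤ δ) {μ : Fin (d + 1)} {y : Site (d + 1)}
    (hcol : ∀ α x, |colH K n μ y α x| ≤ C * Real.exp (-δ * l1 (x - (n : ℤ) • y))) (ϱ : Site (d + 1)) (r : Fin (d + 1) → ℕ) (ξ : ℝ) :
    BiLoc (diagK fun z b => -(∑ α : Fin (d + 1), ∑ x ∈ blockSitesF n (blk n (legSite ϱ z b)), colH K n μ y α x * (ξ * faceWt r n α x)))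
      ((n : ℤ) • y) ((n : ℤ) • y)
      (C * (|ξ| * faceWtSum r n) * Real.exp (δ * (l1 ϱ + ((d + 1 : ℕ) : ℝ) * n))) (δ / 2) :=
  biLoc_diagK_of_abs_le fun z b => by
    rw [abs_neg]
    exact abs_blockSymbol_le_mass_of_col hn hC hδ hcol ϱ (fun Y => le_of_eq (blockMass_smul_faceWt_eq hn r ξ Y)) z b

/-- [folklore] **THE FACE GAUGE GENERATOR IS `BiLoc`, MASS CURRENCY** (`Decays K C δ` form). -/
theorem biLoc_faceGauge_mass {K : MKer (d + 1) (Fib d)} {C δ : ℝ} (hK : Decays K C δ) (hδ : 0 ≤ δ) (ϱ : Site (d + 1)) (r : Fin (d + 1) → ℕ) (ξ : ℝ)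
    (μ : Fin (d + 1)) (y : Site (d + 1)) :
    BiLoc (diagK fun z b => -(∑ α : Fin (d + 1), ∑ x ∈ blockSitesF n (blk n (legSite ϱ z b)), colH K n μ y α x * (ξ * faceWt r n α x)))
      ((n : ℤ) • y) ((n : ℤ) • y)
      (C * (|ξ| * faceWtSum r n) * Real.exp (δ * (l1 ϱ + ((d + 1 : ℕ) : ℝ) * n))) (δ / 2) :=
  biLoc_faceGauge_mass_of_col hn (hK.nonneg (Sum.inl 0)) hδ (fun α x => abs_colH_le (N := n) hK μ y α x) ϱ r ξ

end Mass

end Summit.QuantumFields.BalabanUV.Beta.SymCorrectorFaceWeight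

end
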